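import Literature.MathematicalPhysics.KineticTheory.HardSphereBBGKYLiouvilleSubsystem
import Literature.Analysis.FluidPDE.HardSphereTorusMeasure
import Literature.Analysis.UnboundedOperators.HeatKernelGradient
import HarnessLib

/-!
# Collision windows on the torus: displacement bounds and the Gaussian volume of thin shells

Third file of the proof of `Literature.MathematicalPhysics.KineticTheory.bbgky_hierarchy_of_liouville`
(**hilbert6.S07**; plan in `HardSphereBBGKYLiouvilleFlow`). The `s`-particle marginal of a
transported hard-sphere density changes, along the `s`-particle flow, only through collisions of
a tagged particle with an untagged one (`HardSphereFlow.tagged_flow_eq`,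
`HardSphereBBGKYLiouvilleSubsystem`). This file bounds how many initial data can produce such a
collision in a short time window `h`, with the Gaussian weights of the Lanford class
(CIP 1994 §4.3, estimate of the collision cylinders; GST 2013 Lemma 4.1.2 is the same geometry):

* §1 (kinematics on `T^d`): speeds along a good orbit are bounded by `√(2E)` (energy
  conservation, `HardSphereFlow.configEnergy_flow`); a minimal-image pair distance is
  `2√(2E)`-Lipschitz in time along the orbit (`HardSphereFlow.abs_euclidDist_flow_sub_le`: free
  flight moves it at most by the sum of the two speeds, `Torus.euclidDist_translate_le`, and a
  continuous induction over the collision-free stretches, `IsClosed.Icc_subset_of_forall_mem_nhdsWithin`);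
  hence a pair in contact at some time of a window of length `h` is, at every time of the window,
  at distance in `[ε, ε + 2√(2E) h]` (`HardSphereFlow.euclidDist_flow_le_of_contact`).
* §2 (measure): the Haar measure of a minimal-image shell `{ε ≤ dist ≤ ε + η}` is at most
  `(d vol B₁ + 2) η` for every `η ≥ 0` when `0 < ε ≤ 1/2` (`Torus.volume_shell_le`); and the
  **Gaussian volume of the collision window**: for tagged data `X_s` and `h ≥ 0`,
  `∫_{W_h(X_s)} e^{-β E(X_s, Z')} dZ' ≤ h · A · e^{-β E(X_s)/2}` where
  `W_h(X_s) = {Z' | some tagged–untagged pair at distance ∈ [ε, ε + 2h√(2E(X_s,Z'))]}` and `A`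
  depends only on `β, d, s, m` (`lintegral_window_le`): Tonelli over positions and velocities
  (`MeasurableEquiv.arrowProdEquivProdArrow`), the shell bound for the position of the untagged
  partner, `√(2E) e^{-βE} ≤ (1 + 4/β) e^{-βE/2}`, and finiteness of the Gaussian integral over the
  untagged velocities.

Theorems only; no definition and no named fact is introduced.

## References

* C. Cercignani, R. Illner, M. Pulvirenti, *The Mathematical Theory of Dilute Gases*, Springer
  (1994), §4.3 and App. 4.B (collision cylinders `|x_i - x_j| ∈ [ε, ε + |v| dt]`).
* I. Gallagher, L. Saint-Raymond, B. Texier, *From Newton to Boltzmann*, EMS (2013),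
  arXiv:1208.5753, Lemma 4.1.2 (volume of the set of data leading to a collision in short time).
-/

open MeasureTheory Set Filter Topology Metric
open scoped ENNReal

namespace Literature.MathematicalPhysics.KineticTheory

open Literature.Analysis.FluidPDE

noncomputable section

variable {d : Type*} [Fintype d]

/-! ## §1. Kinematics: speeds and pair distances along an orbit -/

section Kinematics

variable {ε : ℝ} {N : ℕ}

/-- Each speed is at most `√(2E)`. [folklore] -/
theorem norm_vel_le_sqrt_configEnergy {X : Type*} (z : Config N d X) (i : Fin N) :
    ‖(z i).2‖ ≤ Real.sqrt (2 * configEnergy z) :=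
  (le_abs_self _).trans (Real.abs_le_sqrt (norm_vel_sq_le_two_mul_configEnergy z i))

/-- **Speeds along a good orbit are bounded by `√(2E)` of the initial datum** (energy
conservation). [folklore] -/
theorem _root_.Literature.Analysis.FluidPDE.HardSphereFlow.norm_vel_flow_le {X : Type*}
    [MeasureSpace X] [TopologicalSpace X] {G : Geometry d X} (Φ : HardSphereFlow G ε N)
    {z : Config N d X} (hz : z ∈ Φ.good) (t : ℝ) (i : Fin N) :
    ‖(Φ.flow t z i).2‖ ≤ Real.sqrt (2 * configEnergy z) := by
  have h := norm_vel_le_sqrt_configEnergy (Φ.flow t z) i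
  rwa [Φ.configEnergy_flow hz t] at h

/-- Under free flight on the torus a minimal-image pair distance changes by at most
`|t| (‖v_i‖ + ‖v_j‖)`. [folklore] -/
theorem abs_euclidDist_freeFlight_sub_le (t : ℝ) (z : Config N d (UnitAddTorus d)) (i j : Fin N) :
    |Torus.euclidDist (freeFlight (Torus.geometry d) t z i).1 (freeFlight (Torus.geometry d) t z j).1 -
        Torus.euclidDist (z i).1 (z j).1| ≤ |t| * (‖(z i).2‖ + ‖(z j).2‖) := by
  have hn : ‖t • (z i).2 - t • (z j).2‖ ≤ |t| * (‖(z i).2‖ + ‖(z j).2‖) := by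
    calc ‖t • (z i).2 - t • (z j).2‖ ≤ ‖t • (z i).2‖ + ‖t • (z j).2‖ := norm_sub_le _ _
      _ = |t| * (‖(z i).2‖ + ‖(z j).2‖) := by
        rw [norm_smul, norm_smul, Real.norm_eq_abs]; ring
  simp only [freeFlight_apply, Torus.geometry_translate]
  rw [abs_sub_le_iff]
  constructor
  · linarith [Torus.euclidDist_translate_le (z i).1 (z j).1 (t • (z i).2) (t • (z j).2)]
  · linarith [Torus.euclidDist_le_euclidDist_translate (z i).1 (z j).1 (t • (z i).2) (t • (z j).2)]

/-- The pair distance along a good orbit is a continuous function of time (positions are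
continuous, the minimal-image distance is continuous). [folklore] -/
theorem _root_.Literature.Analysis.FluidPDE.HardSphereFlow.continuous_euclidDist_flow
    (Φ : HardSphereFlow (Torus.geometry d) ε N) {z : Config N d (UnitAddTorus d)} (hz : z ∈ Φ.good)
    (i j : Fin N) :
    Continuous fun t => Torus.euclidDist (Φ.flow t z i).1 (Φ.flow t z j).1 := by
  have hγ := Φ.isTrajectory z hz
  have h2 : Continuous fun t => ((Φ.flow t z i).1, (Φ.flow t z j).1) :=
    (hγ.pos_continuous i).prodMk (hγ.pos_continuous j)
  simpa only [Function.comp_def] using Torus.continuous_euclidDist.comp h2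

/-- **Pair distances are `2√(2E)`-Lipschitz in time along a good orbit** (torus): for `t₁ ≤ t₂`,
`|dist_{ij}(t₂) - dist_{ij}(t₁)| ≤ 2√(2E(z)) (t₂ - t₁)`. Between collisions this is the
free-flight bound with the speed bound `√(2E)`; across the (locally finitely many) collisions
positions are continuous, so a continuous induction on `[t₁, t₂]`
(`IsClosed.Icc_subset_of_forall_mem_nhdsWithin`, right collision-free stretches from
`IsHardSphereTrajectory.exists_Ioo_right_free`) propagates the bound. [folklore] -/
theorem _root_.Literature.Analysis.FluidPDE.HardSphereFlow.abs_euclidDist_flow_sub_le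
    (Φ : HardSphereFlow (Torus.geometry d) ε N) {z : Config N d (UnitAddTorus d)} (hz : z ∈ Φ.good)
    (i j : Fin N) {t₁ t₂ : ℝ} (h12 : t₁ ≤ t₂) :
    |Torus.euclidDist (Φ.flow t₂ z i).1 (Φ.flow t₂ z j).1 -
        Torus.euclidDist (Φ.flow t₁ z i).1 (Φ.flow t₁ z j).1| ≤
      2 * Real.sqrt (2 * configEnergy z) * (t₂ - t₁) := by
  have hγ := Φ.isTrajectory z hz
  set V : ℝ := Real.sqrt (2 * configEnergy z) with hV
  set D : ℝ → ℝ := fun t => Torus.euclidDist (Φ.flow t z i).1 (Φ.flow t z j).1 with hD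
  have hDc : Continuous D := Φ.continuous_euclidDist_flow hz i j
  set S : Set ℝ := {t | |D t - D t₁| ≤ 2 * V * (t - t₁)} with hS
  have hSc : IsClosed S := by
    have h1 : Continuous fun t => |D t - D t₁| := (hDc.sub continuous_const).abs
    have h2 : Continuous fun t => 2 * V * (t - t₁) := by fun_prop
    exact isClosed_le h1 h2
  have hmem : t₁ ∈ S := by simp [hS]
  have key : Icc t₁ t₂ ⊆ S := by
    refine (hSc.inter isClosed_Icc).Icc_subset_of_forall_mem_nhdsWithin hmem ?_
    rintro x ⟨hxS, hx⟩
    obtain ⟨u, hxu, hfree⟩ := hγ.exists_Ioo_right_free x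
    refine mem_of_superset (Ioo_mem_nhdsGT hxu) fun t ht => ?_
    -- free flight from `x` on `[x, u)`
    have hff : Φ.flow t z = freeFlight (Torus.geometry d) (t - x) (Φ.flow x z) :=
      hγ.eq_freeFlight_of_Ioo_free hfree ⟨ht.1.le, ht.2⟩
    have hstep : |D t - D x| ≤ 2 * V * (t - x) := by
      have h := abs_euclidDist_freeFlight_sub_le (t - x) (Φ.flow x z) i j
      rw [← hff] at h
      have hvi := Φ.norm_vel_flow_le hz x i
      have hvj := Φ.norm_vel_flow_le hz x j
      have htx : |t - x| = t - x := abs_of_pos (sub_pos.2 ht.1)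
      calc |D t - D x| ≤ |t - x| * (‖(Φ.flow x z i).2‖ + ‖(Φ.flow x z j).2‖) := h
        _ ≤ (t - x) * (V + V) := by rw [htx]; gcongr; linarith [ht.1]
        _ = 2 * V * (t - x) := by ring
    show |D t - D t₁| ≤ 2 * V * (t - t₁)
    have hxS' : |D x - D t₁| ≤ 2 * V * (x - t₁) := hxS
    calc |D t - D t₁| = |(D t - D x) + (D x - D t₁)| := by ring_nf
      _ ≤ |D t - D x| + |D x - D t₁| := abs_add_le _ _
      _ ≤ 2 * V * (t - x) + 2 * V * (x - t₁) := add_le_add hstep hxS'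
      _ = 2 * V * (t - t₁) := by ring
  exact key ⟨h12, le_rfl⟩

/-- The same with the roles of the two times free: `|dist(t) - dist(t')| ≤ 2√(2E) |t - t'|`. [folklore] -/
theorem _root_.Literature.Analysis.FluidPDE.HardSphereFlow.abs_euclidDist_flow_sub_le'
    (Φ : HardSphereFlow (Torus.geometry d) ε N) {z : Config N d (UnitAddTorus d)} (hz : z ∈ Φ.good)
    (i j : Fin N) (t t' : ℝ) :
    |Torus.euclidDist (Φ.flow t z i).1 (Φ.flow t z j).1 -
        Torus.euclidDist (Φ.flow t' z i).1 (Φ.flow t' z j).1| ≤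
      2 * Real.sqrt (2 * configEnergy z) * |t - t'| := by
  rcases le_total t' t with h | h
  · rw [abs_of_nonneg (sub_nonneg.2 h)]
    exact Φ.abs_euclidDist_flow_sub_le hz i j h
  · rw [abs_sub_comm, abs_of_nonpos (sub_nonpos.2 h), neg_sub]
    exact Φ.abs_euclidDist_flow_sub_le hz i j h

/-- **A pair in contact at time `τ` is, at any time `t`, at distance in
`[ε, ε + 2√(2E) |t - τ|]`** (torus; the lower bound is membership in the hard-sphere domain). [folklore] -/
theorem _root_.Literature.Analysis.FluidPDE.HardSphereFlow.euclidDist_flow_le_of_contact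
    (Φ : HardSphereFlow (Torus.geometry d) ε N) {z : Config N d (UnitAddTorus d)} (hz : z ∈ Φ.good)
    {I J : Fin N} (hIJ : I ≠ J) {τ : ℝ} (hc : Φ.flow τ z ∈ contactSet (Torus.geometry d) N ε I J)
    (t : ℝ) :
    ε ≤ Torus.euclidDist (Φ.flow t z I).1 (Φ.flow t z J).1 ∧
      Torus.euclidDist (Φ.flow t z I).1 (Φ.flow t z J).1 ≤
        ε + 2 * Real.sqrt (2 * configEnergy z) * |t - τ| := by
  have hγ := Φ.isTrajectory z hz
  constructor
  · have h := (mem_hardSphereDomain.1 (hγ.mem t)) I J hIJ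
    rwa [Torus.norm_geometry_sepVec] at h
  · have hτ : Torus.euclidDist (Φ.flow τ z I).1 (Φ.flow τ z J).1 = ε := by
      rw [← Torus.norm_geometry_sepVec]; exact (mem_contactSet.1 hc).2
    have h := Φ.abs_euclidDist_flow_sub_le' hz I J t τ
    rw [hτ, abs_sub_le_iff] at h
    linarith [h.1]

end Kinematics

/-! ## §2. Measure: minimal-image shells and the Gaussian volume of the collision window -/

section Shell

/-- **The Haar measure of a minimal-image shell, all widths**: for `0 < ε ≤ 1/2` and `η ≥ 0`,
`vol {x ∈ T^d | ε ≤ dist(x, y) ≤ ε + η} ≤ (d · vol B₁ + 2) η`. For `η ≤ 1/2` the shell is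
contained (through `reprSym`) in the Euclidean shell `B̄_{ε+η} ∖ B_ε`, of volume
`vol B₁ ((ε+η)^d - ε^d) ≤ d η vol B₁` (`Torus.pow_add_sub_pow_le`, `ε + η ≤ 1`); for `η > 1/2`
the total mass `1` is at most `2η`. (Companion of `Torus.volume_annulus_le`, which needs
`ε + η < 1/2`.) [folklore] -/
theorem volume_shell_le {ε η : ℝ} (hε : 0 < ε) (hε2 : ε ≤ 1 / 2) (hη : 0 ≤ η) (y : UnitAddTorus d) :
    volume {x : UnitAddTorus d | ε ≤ Torus.euclidDist x y ∧ Torus.euclidDist x y ≤ ε + η} ≤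
      ENNReal.ofReal ((Fintype.card d *
        (volume (ball (0 : EuclideanSpace ℝ d) 1)).toReal + 2) * η) := by
  set Kb : ℝ := (volume (ball (0 : EuclideanSpace ℝ d) 1)).toReal with hKb
  have hKb0 : 0 ≤ Kb := ENNReal.toReal_nonneg
  have hballfin : volume (ball (0 : EuclideanSpace ℝ d) 1) ≠ ∞ := measure_ball_lt_top.ne
  by_cases hηs : η ≤ 1 / 2
  · -- thin shell: compare with the Euclidean shell
    have hB : MeasurableSet (closedBall (0 : EuclideanSpace ℝ d) (ε + η) \ ball 0 ε) :=
      measurableSet_closedBall.diff measurableSet_ball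
    have hset : {x : UnitAddTorus d | ε ≤ Torus.euclidDist x y ∧ Torus.euclidDist x y ≤ ε + η} =
        {x | Torus.reprSym (x - y) ∈ closedBall (0 : EuclideanSpace ℝ d) (ε + η) \ ball 0 ε} := by
      ext x
      simp only [mem_setOf_eq, Torus.euclidDist, Set.mem_sdiff, mem_closedBall, dist_zero_right, mem_ball,
        not_lt]
      tauto
    rw [hset, Torus.volume_reprSym_sub_mem y hB]
    calc volume ((closedBall (0 : EuclideanSpace ℝ d) (ε + η) \ ball 0 ε) ∩ Torus.symCube d)
        ≤ volume (closedBall (0 : EuclideanSpace ℝ d) (ε + η) \ ball 0 ε) :=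
          measure_mono inter_subset_left
      _ = volume (closedBall (0 : EuclideanSpace ℝ d) (ε + η)) - volume (ball (0 : EuclideanSpace ℝ d) ε) :=
          measure_sdiff (ball_subset_closedBall.trans (closedBall_subset_closedBall (by linarith)))
            measurableSet_ball.nullMeasurableSet measure_ball_lt_top.ne
      _ = (ENNReal.ofReal ((ε + η) ^ Fintype.card d) - ENNReal.ofReal (ε ^ Fintype.card d)) *
            volume (ball (0 : EuclideanSpace ℝ d) 1) := by
          rw [Measure.addHaar_closedBall _ _ (by linarith), Measure.addHaar_ball_of_pos _ _ hε,
            finrank_euclideanSpace, ENNReal.sub_mul fun _ _ => hballfin]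
      _ = ENNReal.ofReal ((ε + η) ^ Fintype.card d - ε ^ Fintype.card d) *
            volume (ball (0 : EuclideanSpace ℝ d) 1) := by
          rw [ENNReal.ofReal_sub _ (by positivity)]
      _ ≤ ENNReal.ofReal (Fintype.card d * η) * volume (ball (0 : EuclideanSpace ℝ d) 1) := by
          gcongr
          exact Torus.pow_add_sub_pow_le hε.le hη (by linarith) _
      _ = ENNReal.ofReal (Fintype.card d * η * Kb) := by
          rw [ENNReal.ofReal_mul' hKb0, hKb, ENNReal.ofReal_toReal hballfin]
      _ ≤ ENNReal.ofReal ((Fintype.card d * Kb + 2) * η) := by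
          apply ENNReal.ofReal_le_ofReal
          nlinarith
  · -- thick shell: total mass one
    push Not at hηs
    have huniv : volume (univ : Set (UnitAddTorus d)) = 1 := by
      rw [volume_pi, Measure.pi_univ]
      simp
    calc volume {x : UnitAddTorus d | ε ≤ Torus.euclidDist x y ∧ Torus.euclidDist x y ≤ ε + η}
        ≤ volume (univ : Set (UnitAddTorus d)) := measure_mono (subset_univ _)
      _ = 1 := huniv
      _ ≤ ENNReal.ofReal ((Fintype.card d * Kb + 2) * η) := by
          rw [← ENNReal.ofReal_one]
          apply ENNReal.ofReal_le_ofReal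
          nlinarith [mul_nonneg (Nat.cast_nonneg (Fintype.card d)) hKb0]

end Shell

section Window

variable {ε β : ℝ} {s m : ℕ}

/-- The energy of a juxtaposed configuration is the sum of the energies. [folklore] -/
theorem configEnergy_append {X : Type*} (Xs : Config s d X) (Zm : Config m d X) :
    configEnergy (Fin.append Xs Zm) = configEnergy Xs + configEnergy Zm := by
  simp only [configEnergy, Fin.sum_univ_add, Fin.append_left, Fin.append_right]
  ring

/-- Elementary: `√(2x) e^{-βx} ≤ (1 + 4/β) e^{-βx/2}` for `x ≥ 0`, `β > 0`. [folklore] -/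
theorem sqrt_two_mul_mul_exp_neg_le {β x : ℝ} (hβ : 0 < β) (hx : 0 ≤ x) :
    Real.sqrt (2 * x) * Real.exp (-β * x) ≤ (1 + 4 / β) * Real.exp (-(β / 2) * x) := by
  -- `√(2x) ≤ 1 + 2x`
  have h1 : Real.sqrt (2 * x) ≤ 1 + 2 * x := by
    rw [Real.sqrt_le_left (by positivity)]
    nlinarith
  -- `2x e^{-βx/2} ≤ 4/β`
  have h2 : 2 * x * Real.exp (-(β / 2) * x) ≤ 4 / β := by
    have h := Real.add_one_le_exp ((β / 2) * x)
    have hpos : 0 < Real.exp ((β / 2) * x) := Real.exp_pos _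
    have hinv : Real.exp (-(β / 2) * x) = (Real.exp ((β / 2) * x))⁻¹ := by
      rw [← Real.exp_neg]; congr 1; ring
    rw [hinv, ← div_eq_mul_inv, div_le_div_iff₀ hpos hβ]
    nlinarith
  have hsplit : Real.exp (-β * x) = Real.exp (-(β / 2) * x) * Real.exp (-(β / 2) * x) := by
    rw [← Real.exp_add]; congr 1; ring
  have hE : 0 < Real.exp (-(β / 2) * x) := Real.exp_pos _
  calc Real.sqrt (2 * x) * Real.exp (-β * x)
      ≤ (1 + 2 * x) * Real.exp (-β * x) := by gcongr
    _ = (Real.exp (-(β / 2) * x) + 2 * x * Real.exp (-(β / 2) * x)) * Real.exp (-(β / 2) * x) := by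
        rw [hsplit]; ring
    _ ≤ (1 + 4 / β) * Real.exp (-(β / 2) * x) := by
        gcongr
        · calc Real.exp (-(β / 2) * x) ≤ Real.exp 0 := Real.exp_le_exp.2 (by nlinarith)
            _ = 1 := Real.exp_zero

/-- The Gaussian in the untagged velocities is integrable: `V ↦ e^{-(β/2) · ½ ∑_k ‖V_k‖²}`
(a finite product of Gaussians on `ℝ^d`). [folklore] -/
theorem integrable_exp_neg_mul_half_sum_norm_sq (hβ : 0 < β) :
    Integrable (fun V : Fin m → EuclideanSpace ℝ d =>
      Real.exp (-(β / 2) * (2⁻¹ * ∑ k, ‖V k‖ ^ 2))) := by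
  have h1 : ∀ k : Fin m, Integrable (fun v : EuclideanSpace ℝ d => Real.exp (-(β / 4) * ‖v‖ ^ 2)) :=
    fun _ => Literature.Analysis.UnboundedOperators.integrable_gaussian_of_pos (by positivity)
  have h2 := Integrable.fintype_prod (ι := Fin m) (μ := fun _ => (volume : Measure (EuclideanSpace ℝ d)))
    (f := fun _ v => Real.exp (-(β / 4) * ‖v‖ ^ 2)) h1
  rw [← volume_pi] at h2
  refine h2.congr (Eventually.of_forall fun V => ?_)
  simp only
  rw [← Real.exp_sum, Finset.mul_sum, Finset.mul_sum]
  congr 1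
  refine Finset.sum_congr rfl fun k _ => ?_
  ring

/-- The position integral of a shell indicator in one coordinate of `(T^d)^m` is the Haar
measure of the shell, hence at most `(d vol B₁ + 2) η` (`volume_shell_le`; the other coordinates
have total mass one, `measurePreserving_eval`). [folklore] -/
theorem lintegral_shell_indicator_eval_le (hε : 0 < ε) (hε2 : ε ≤ 1 / 2) (x₀ : UnitAddTorus d)
    {η : ℝ} (hη : 0 ≤ η) (j : Fin m) :
    ∫⁻ P : Fin m → UnitAddTorus d,
        {x : UnitAddTorus d | ε ≤ Torus.euclidDist x x₀ ∧ Torus.euclidDist x x₀ ≤ ε + η}.indicator 1 (P j) ≤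
      ENNReal.ofReal ((Fintype.card d *
        (volume (ball (0 : EuclideanSpace ℝ d) 1)).toReal + 2) * η) := by
  have hSm : MeasurableSet {x : UnitAddTorus d | ε ≤ Torus.euclidDist x x₀ ∧ Torus.euclidDist x x₀ ≤ ε + η} := by
    have hc : Continuous fun x : UnitAddTorus d => Torus.euclidDist x x₀ := by
      simpa only [Function.comp_def, id_eq] using
        Torus.continuous_euclidDist.comp (continuous_id.prodMk continuous_const)
    exact (measurableSet_le measurable_const hc.measurable).inter
      (measurableSet_le hc.measurable measurable_const)
  have huniv : volume (univ : Set (UnitAddTorus d)) = 1 := by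
    rw [volume_pi, Measure.pi_univ]
    simp
  haveI : IsProbabilityMeasure (volume : Measure (UnitAddTorus d)) := ⟨huniv⟩
  have hev : MeasurePreserving (Function.eval j)
      (volume : Measure (Fin m → UnitAddTorus d)) (volume : Measure (UnitAddTorus d)) := by
    rw [volume_pi]
    exact measurePreserving_eval _ j
  calc ∫⁻ P : Fin m → UnitAddTorus d,
        {x : UnitAddTorus d | ε ≤ Torus.euclidDist x x₀ ∧ Torus.euclidDist x x₀ ≤ ε + η}.indicator 1 (P j)
      = ∫⁻ x : UnitAddTorus d,
          {x : UnitAddTorus d | ε ≤ Torus.euclidDist x x₀ ∧ Torus.euclidDist x x₀ ≤ ε + η}.indicator 1 x := by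
        rw [← hev.lintegral_comp (measurable_one.indicator hSm)]
    _ = volume {x : UnitAddTorus d | ε ≤ Torus.euclidDist x x₀ ∧ Torus.euclidDist x x₀ ≤ ε + η} :=
        lintegral_indicator_one hSm
    _ ≤ _ := volume_shell_le hε hε2 hη x₀

/-- The energy of the untagged configuration `k ↦ (P k, V k)`. [folklore] -/
theorem configEnergy_zip (P : Fin m → UnitAddTorus d) (V : Fin m → EuclideanSpace ℝ d) :
    configEnergy (fun k => (P k, V k) : Config m d (UnitAddTorus d)) = 2⁻¹ * ∑ k, ‖V k‖ ^ 2 := rfl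

/-- **Pointwise bound of the window integrand** in the product picture: the Gaussian weight
restricted to the window set is at most the Gaussian weight times the number of tagged–untagged
pairs whose untagged partner lies in the corresponding shell. [folklore] -/
theorem window_indicator_le (Xs : Config s d (UnitAddTorus d)) (h : ℝ)
    (P : Fin m → UnitAddTorus d) (V : Fin m → EuclideanSpace ℝ d) :
    {Zm : Config m d (UnitAddTorus d) | ∃ (i : Fin s) (j : Fin m),
        ε ≤ Torus.euclidDist (Xs i).1 (Zm j).1 ∧
          Torus.euclidDist (Xs i).1 (Zm j).1 ≤
            ε + 2 * h * Real.sqrt (2 * configEnergy (Fin.append Xs Zm))}.indicator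
        (fun Zm => ENNReal.ofReal (Real.exp (-β * configEnergy (Fin.append Xs Zm))))
        (fun k => (P k, V k)) ≤
      ENNReal.ofReal (Real.exp (-β * (configEnergy Xs + 2⁻¹ * ∑ k, ‖V k‖ ^ 2))) *
        ∑ i : Fin s, ∑ j : Fin m,
          {x : UnitAddTorus d | ε ≤ Torus.euclidDist x (Xs i).1 ∧ Torus.euclidDist x (Xs i).1 ≤
            ε + 2 * h * Real.sqrt (2 * (configEnergy Xs + 2⁻¹ * ∑ k, ‖V k‖ ^ 2))}.indicator 1 (P j) := by
  have hE : configEnergy (Fin.append Xs (fun k => (P k, V k) : Config m d (UnitAddTorus d))) =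
      configEnergy Xs + 2⁻¹ * ∑ k, ‖V k‖ ^ 2 := by
    rw [configEnergy_append, configEnergy_zip P V]
  by_cases hmem : (fun k => (P k, V k) : Config m d (UnitAddTorus d)) ∈
      {Zm : Config m d (UnitAddTorus d) | ∃ (i : Fin s) (j : Fin m),
        ε ≤ Torus.euclidDist (Xs i).1 (Zm j).1 ∧
          Torus.euclidDist (Xs i).1 (Zm j).1 ≤
            ε + 2 * h * Real.sqrt (2 * configEnergy (Fin.append Xs Zm))}
  · rw [indicator_of_mem hmem, hE]
    refine le_mul_of_one_le_right zero_le ?_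
    obtain ⟨i, j, h1, h2⟩ := hmem
    rw [hE] at h2
    have hij : {x : UnitAddTorus d | ε ≤ Torus.euclidDist x (Xs i).1 ∧ Torus.euclidDist x (Xs i).1 ≤
        ε + 2 * h * Real.sqrt (2 * (configEnergy Xs + 2⁻¹ * ∑ k, ‖V k‖ ^ 2))}.indicator
          (1 : UnitAddTorus d → ℝ≥0∞) (P j) = 1 := by
      rw [indicator_of_mem]
      · rfl
      · refine ⟨?_, ?_⟩
        · rw [Torus.euclidDist_comm]; exact h1
        · rw [Torus.euclidDist_comm]; exact h2
    calc (1 : ℝ≥0∞) = _ := hij.symm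
      _ ≤ ∑ j' : Fin m, {x : UnitAddTorus d | ε ≤ Torus.euclidDist x (Xs i).1 ∧
            Torus.euclidDist x (Xs i).1 ≤
              ε + 2 * h * Real.sqrt (2 * (configEnergy Xs + 2⁻¹ * ∑ k, ‖V k‖ ^ 2))}.indicator 1 (P j') :=
          Finset.single_le_sum (f := fun j' => {x : UnitAddTorus d | ε ≤ Torus.euclidDist x (Xs i).1 ∧
            Torus.euclidDist x (Xs i).1 ≤
              ε + 2 * h * Real.sqrt (2 * (configEnergy Xs + 2⁻¹ * ∑ k, ‖V k‖ ^ 2))}.indicator 1 (P j'))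
            (fun _ _ => zero_le) (Finset.mem_univ j)
      _ ≤ ∑ i' : Fin s, ∑ j' : Fin m, {x : UnitAddTorus d | ε ≤ Torus.euclidDist x (Xs i').1 ∧
            Torus.euclidDist x (Xs i').1 ≤
              ε + 2 * h * Real.sqrt (2 * (configEnergy Xs + 2⁻¹ * ∑ k, ‖V k‖ ^ 2))}.indicator 1 (P j') :=
          Finset.single_le_sum (f := fun i' => ∑ j' : Fin m, {x : UnitAddTorus d |
            ε ≤ Torus.euclidDist x (Xs i').1 ∧ Torus.euclidDist x (Xs i').1 ≤
              ε + 2 * h * Real.sqrt (2 * (configEnergy Xs + 2⁻¹ * ∑ k, ‖V k‖ ^ 2))}.indicator 1 (P j'))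
            (fun _ _ => zero_le) (Finset.mem_univ i)
  · rw [indicator_of_notMem hmem]
    exact zero_le

/-- Measurability, in the product picture `(positions, velocities)`, of the shell indicator of
the `j`-th untagged position with velocity-dependent width. [folklore] -/
theorem measurable_shell_indicator_prod (x₀ : UnitAddTorus d) (c h : ℝ) (j : Fin m) :
    Measurable fun p : (Fin m → UnitAddTorus d) × (Fin m → EuclideanSpace ℝ d) =>
      {x : UnitAddTorus d | ε ≤ Torus.euclidDist x x₀ ∧ Torus.euclidDist x x₀ ≤
        ε + 2 * h * Real.sqrt (2 * (c + 2⁻¹ * ∑ k, ‖p.2 k‖ ^ 2))}.indicator (1 : UnitAddTorus d → ℝ≥0∞)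
        (p.1 j) := by
  have hc1 : Measurable fun p : (Fin m → UnitAddTorus d) × (Fin m → EuclideanSpace ℝ d) =>
      Torus.euclidDist (p.1 j) x₀ := by
    have hc : Continuous fun p : (Fin m → UnitAddTorus d) × (Fin m → EuclideanSpace ℝ d) =>
        Torus.euclidDist (p.1 j) x₀ := by
      have h1 : Continuous fun p : (Fin m → UnitAddTorus d) × (Fin m → EuclideanSpace ℝ d) =>
          (p.1 j, x₀) := ((continuous_apply j).comp continuous_fst).prodMk continuous_const
      simpa only [Function.comp_def] using Torus.continuous_euclidDist.comp h1
    exact hc.measurable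
  have hc2 : Measurable fun p : (Fin m → UnitAddTorus d) × (Fin m → EuclideanSpace ℝ d) =>
      ε + 2 * h * Real.sqrt (2 * (c + 2⁻¹ * ∑ k, ‖p.2 k‖ ^ 2)) := by
    fun_prop
  have hset : MeasurableSet {p : (Fin m → UnitAddTorus d) × (Fin m → EuclideanSpace ℝ d) |
      ε ≤ Torus.euclidDist (p.1 j) x₀ ∧ Torus.euclidDist (p.1 j) x₀ ≤
        ε + 2 * h * Real.sqrt (2 * (c + 2⁻¹ * ∑ k, ‖p.2 k‖ ^ 2))} :=
    (measurableSet_le measurable_const hc1).inter (measurableSet_le hc1 hc2)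
  have : (fun p : (Fin m → UnitAddTorus d) × (Fin m → EuclideanSpace ℝ d) =>
      {x : UnitAddTorus d | ε ≤ Torus.euclidDist x x₀ ∧ Torus.euclidDist x x₀ ≤
        ε + 2 * h * Real.sqrt (2 * (c + 2⁻¹ * ∑ k, ‖p.2 k‖ ^ 2))}.indicator (1 : UnitAddTorus d → ℝ≥0∞)
        (p.1 j)) =
      {p : (Fin m → UnitAddTorus d) × (Fin m → EuclideanSpace ℝ d) |
        ε ≤ Torus.euclidDist (p.1 j) x₀ ∧ Torus.euclidDist (p.1 j) x₀ ≤
          ε + 2 * h * Real.sqrt (2 * (c + 2⁻¹ * ∑ k, ‖p.2 k‖ ^ 2))}.indicator 1 := by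
    funext p
    simp only [indicator, mem_setOf_eq, Pi.one_apply]
  rw [this]
  exact measurable_one.indicator hset

/-- The window set is measurable. [folklore] -/
theorem measurableSet_window (Xs : Config s d (UnitAddTorus d)) (h : ℝ) :
    MeasurableSet {Zm : Config m d (UnitAddTorus d) | ∃ (i : Fin s) (j : Fin m),
        ε ≤ Torus.euclidDist (Xs i).1 (Zm j).1 ∧
          Torus.euclidDist (Xs i).1 (Zm j).1 ≤
            ε + 2 * h * Real.sqrt (2 * configEnergy (Fin.append Xs Zm))} := by
  have hW' : {Zm : Config m d (UnitAddTorus d) | ∃ (i : Fin s) (j : Fin m),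
      ε ≤ Torus.euclidDist (Xs i).1 (Zm j).1 ∧
        Torus.euclidDist (Xs i).1 (Zm j).1 ≤
          ε + 2 * h * Real.sqrt (2 * configEnergy (Fin.append Xs Zm))} =
      ⋃ (i : Fin s) (j : Fin m), {Zm | ε ≤ Torus.euclidDist (Xs i).1 (Zm j).1 ∧
        Torus.euclidDist (Xs i).1 (Zm j).1 ≤
          ε + 2 * h * Real.sqrt (2 * configEnergy (Fin.append Xs Zm))} := by
    ext Zm
    simp only [mem_setOf_eq, mem_iUnion]
  rw [hW']
  refine MeasurableSet.iUnion fun i => MeasurableSet.iUnion fun j => ?_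
  have hc1 : Measurable fun Zm : Config m d (UnitAddTorus d) => Torus.euclidDist (Xs i).1 (Zm j).1 := by
    have hc : Continuous fun Zm : Config m d (UnitAddTorus d) => Torus.euclidDist (Xs i).1 (Zm j).1 := by
      have h1 : Continuous fun Zm : Config m d (UnitAddTorus d) => ((Xs i).1, (Zm j).1) := by fun_prop
      simpa only [Function.comp_def] using Torus.continuous_euclidDist.comp h1
    exact hc.measurable
  have hc2 : Measurable fun Zm : Config m d (UnitAddTorus d) =>
      ε + 2 * h * Real.sqrt (2 * configEnergy (Fin.append Xs Zm)) := by
    have : Measurable fun Zm : Config m d (UnitAddTorus d) => configEnergy (Fin.append Xs Zm) := by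
      simp only [configEnergy_append]
      refine measurable_const.add ?_
      unfold configEnergy
      fun_prop
    fun_prop
  exact (measurableSet_le measurable_const hc1).inter (measurableSet_le hc1 hc2)

/-- **The Gaussian volume of the collision window.** For `0 < ε ≤ 1/2`, `0 < β` and
`s, m`, there is `A ≥ 0` such that for every `h ≥ 0` and every tagged configuration `X_s`,
`∫_{W} e^{-β E(X_s, Z')} dZ' ≤ h · A · e^{-(β/2) E(X_s)}`, where
`W = {Z' | ∃ i j, ε ≤ dist(x_i, x'_j) ≤ ε + 2h √(2E(X_s, Z'))}` is the set of untagged data with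
some tagged–untagged pair in the collision window of duration `h` (the set outside of which no
such pair can touch within time `h`, `HardSphereFlow.euclidDist_flow_le_of_contact`). Proof:
Tonelli over positions and velocities of `Z'` (`MeasurableEquiv.arrowProdEquivProdArrow`); for
fixed velocities the window for the pair `(i, j)` constrains `x'_j` to a shell of width
`2h√(2E)`, of Haar measure `≤ K · 2h√(2E)` (`volume_shell_le`), the other positions having mass
one; then `√(2E) e^{-βE} ≤ (1 + 4/β) e^{-βE/2}` (`sqrt_two_mul_mul_exp_neg_le`),
`E = E(X_s) + E(Z')`, and the Gaussian integral over the untagged velocities is finite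
(CIP 1994 §4.3 / App. 4.B: the measure of a collision cylinder is `O(dt)`). [cite: CIP1994, App. 4.B] -/
theorem lintegral_window_le (hε : 0 < ε) (hε2 : ε ≤ 1 / 2) (hβ : 0 < β) (s m : ℕ) :
    ∃ A : ℝ, 0 ≤ A ∧ ∀ h : ℝ, 0 ≤ h → ∀ Xs : Config s d (UnitAddTorus d),
      ∫⁻ Zm in {Zm : Config m d (UnitAddTorus d) | ∃ (i : Fin s) (j : Fin m),
          ε ≤ Torus.euclidDist (Xs i).1 (Zm j).1 ∧
            Torus.euclidDist (Xs i).1 (Zm j).1 ≤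
              ε + 2 * h * Real.sqrt (2 * configEnergy (Fin.append Xs Zm))},
        ENNReal.ofReal (Real.exp (-β * configEnergy (Fin.append Xs Zm))) ≤
      ENNReal.ofReal (h * A * Real.exp (-(β / 2) * configEnergy Xs)) := by
  classical
  -- constants (kept opaque)
  obtain ⟨K, hK⟩ : ∃ K : ℝ, K = Fintype.card d * (volume (ball (0 : EuclideanSpace ℝ d) 1)).toReal + 2 :=
    ⟨_, rfl⟩
  have hK0 : 0 ≤ K := by rw [hK]; positivity
  obtain ⟨gV, hgV⟩ : ∃ gV : (Fin m → EuclideanSpace ℝ d) → ℝ,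
      gV = fun V => Real.exp (-(β / 2) * (2⁻¹ * ∑ k, ‖V k‖ ^ 2)) := ⟨_, rfl⟩
  have hgi : Integrable gV := by rw [hgV]; exact integrable_exp_neg_mul_half_sum_norm_sq hβ
  have hgVm : Measurable gV := by rw [hgV]; fun_prop
  have hgV0 : ∀ V, 0 ≤ gV V := fun V => by rw [hgV]; exact (Real.exp_pos _).le
  obtain ⟨IV, hIV⟩ : ∃ IV : ℝ, IV = ∫ V, gV V := ⟨_, rfl⟩
  have hIV0 : 0 ≤ IV := by rw [hIV]; exact integral_nonneg hgV0
  obtain ⟨C, hC⟩ : ∃ C : ℝ, C = 2 * (s * m) * K * (1 + 4 / β) := ⟨_, rfl⟩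
  have hC0 : 0 ≤ C := by rw [hC]; positivity
  refine ⟨C * IV, by positivity, fun h hh Xs => ?_⟩
  -- abbreviations
  have hEX0 : 0 ≤ configEnergy Xs := by unfold configEnergy; positivity
  -- the product decomposition of `Config m`
  have hemp : MeasurePreserving
      (MeasurableEquiv.arrowProdEquivProdArrow (UnitAddTorus d) (EuclideanSpace ℝ d) (Fin m)) :=
    volume_measurePreserving_arrowProdEquivProdArrow _ _ _
  have hsymm : ∀ p : (Fin m → UnitAddTorus d) × (Fin m → EuclideanSpace ℝ d),
      (MeasurableEquiv.arrowProdEquivProdArrow (UnitAddTorus d) (EuclideanSpace ℝ d) (Fin m)).symm p =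
        fun k => (p.1 k, p.2 k) := fun _ => rfl
  -- opaque names for the integrands
  obtain ⟨Fw, hFw⟩ : ∃ Fw : Config m d (UnitAddTorus d) → ℝ≥0∞,
      Fw = {Zm : Config m d (UnitAddTorus d) | ∃ (i : Fin s) (j : Fin m),
          ε ≤ Torus.euclidDist (Xs i).1 (Zm j).1 ∧
            Torus.euclidDist (Xs i).1 (Zm j).1 ≤
              ε + 2 * h * Real.sqrt (2 * configEnergy (Fin.append Xs Zm))}.indicator
          (fun Zm => ENNReal.ofReal (Real.exp (-β * configEnergy (Fin.append Xs Zm)))) := ⟨_, rfl⟩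
  obtain ⟨G, hG⟩ : ∃ G : (Fin m → UnitAddTorus d) × (Fin m → EuclideanSpace ℝ d) → ℝ≥0∞,
      G = fun p => ENNReal.ofReal (Real.exp (-β * (configEnergy Xs + 2⁻¹ * ∑ k, ‖p.2 k‖ ^ 2))) *
        ∑ i : Fin s, ∑ j : Fin m,
          {x : UnitAddTorus d | ε ≤ Torus.euclidDist x (Xs i).1 ∧ Torus.euclidDist x (Xs i).1 ≤
            ε + 2 * h * Real.sqrt (2 * (configEnergy Xs + 2⁻¹ * ∑ k, ‖p.2 k‖ ^ 2))}.indicator 1 (p.1 j) :=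
    ⟨_, rfl⟩
  obtain ⟨R, hR⟩ : ∃ R : (Fin m → EuclideanSpace ℝ d) → ℝ≥0∞,
      R = fun V => ENNReal.ofReal (Real.exp (-β * (configEnergy Xs + 2⁻¹ * ∑ k, ‖V k‖ ^ 2))) *
        ∑ i : Fin s, ∑ j : Fin m, ∫⁻ P : Fin m → UnitAddTorus d,
          {x : UnitAddTorus d | ε ≤ Torus.euclidDist x (Xs i).1 ∧ Torus.euclidDist x (Xs i).1 ≤
            ε + 2 * h * Real.sqrt (2 * (configEnergy Xs + 2⁻¹ * ∑ k, ‖V k‖ ^ 2))}.indicator 1 (P j) :=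
    ⟨_, rfl⟩
  -- Step 1: pass to the product picture
  have hstep1 : ∫⁻ Zm in {Zm : Config m d (UnitAddTorus d) | ∃ (i : Fin s) (j : Fin m),
          ε ≤ Torus.euclidDist (Xs i).1 (Zm j).1 ∧
            Torus.euclidDist (Xs i).1 (Zm j).1 ≤
              ε + 2 * h * Real.sqrt (2 * configEnergy (Fin.append Xs Zm))},
        ENNReal.ofReal (Real.exp (-β * configEnergy (Fin.append Xs Zm))) =
      ∫⁻ p : (Fin m → UnitAddTorus d) × (Fin m → EuclideanSpace ℝ d), Fw (fun k => (p.1 k, p.2 k)) := by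
    rw [← lintegral_indicator (measurableSet_window Xs h), ← hFw,
      ← hemp.symm.lintegral_comp_emb (MeasurableEquiv.measurableEmbedding _)]
    simp only [hsymm]
  -- Step 2: pointwise bound and Tonelli (velocities outside, positions inside)
  have hGmeas : Measurable G := by
    rw [hG]
    refine Measurable.mul ?_ (Finset.measurable_sum _ fun i _ => Finset.measurable_sum _ fun j _ =>
      measurable_shell_indicator_prod (Xs i).1 (configEnergy Xs) h j)
    refine ENNReal.measurable_ofReal.comp ?_
    fun_prop
  have hle : ∀ p : (Fin m → UnitAddTorus d) × (Fin m → EuclideanSpace ℝ d),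
      Fw (fun k => (p.1 k, p.2 k)) ≤ G p := fun p => by
    rw [hFw, hG]
    exact window_indicator_le Xs h p.1 p.2
  have hT : ∫⁻ p, G p = ∫⁻ V : Fin m → EuclideanSpace ℝ d, ∫⁻ P : Fin m → UnitAddTorus d, G (P, V) :=
    lintegral_prod_symm' _ hGmeas
  have hinner : ∀ V : Fin m → EuclideanSpace ℝ d, ∫⁻ P : Fin m → UnitAddTorus d, G (P, V) = R V := by
    intro V
    have hm : ∀ (i : Fin s) (j : Fin m), Measurable fun P : Fin m → UnitAddTorus d =>
        {x : UnitAddTorus d | ε ≤ Torus.euclidDist x (Xs i).1 ∧ Torus.euclidDist x (Xs i).1 ≤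
          ε + 2 * h * Real.sqrt (2 * (configEnergy Xs + 2⁻¹ * ∑ k, ‖V k‖ ^ 2))}.indicator
          (1 : UnitAddTorus d → ℝ≥0∞) (P j) := by
      intro i j
      have := (measurable_shell_indicator_prod (m := m) (ε := ε) (Xs i).1 (configEnergy Xs) h j).comp
        (measurable_id.prodMk (measurable_const (a := V)))
      exact this
    rw [hR, hG]
    simp only
    rw [lintegral_const_mul _ (Finset.measurable_sum _ fun i _ => Finset.measurable_sum _
      fun j _ => hm i j)]
    congr 1
    rw [lintegral_finsetSum _ fun i _ => Finset.measurable_sum _ fun j _ => hm i j]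
    refine Finset.sum_congr rfl fun i _ => ?_
    rw [lintegral_finsetSum _ fun j _ => hm i j]
  -- Step 3: each position integral is a shell volume; assemble the velocity integrand
  have hstep3 : ∀ V : Fin m → EuclideanSpace ℝ d,
      R V ≤ ENNReal.ofReal (h * C * Real.exp (-(β / 2) * configEnergy Xs)) * ENNReal.ofReal (gV V) := by
    intro V
    rw [hR]
    simp only
    have hEV0 : 0 ≤ 2⁻¹ * ∑ k, ‖V k‖ ^ 2 := by positivity
    have hw0 : 0 ≤ 2 * h * Real.sqrt (2 * (configEnergy Xs + 2⁻¹ * ∑ k, ‖V k‖ ^ 2)) := by positivity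
    have hsum : ∑ i : Fin s, ∑ j : Fin m, ∫⁻ P : Fin m → UnitAddTorus d,
            {x : UnitAddTorus d | ε ≤ Torus.euclidDist x (Xs i).1 ∧ Torus.euclidDist x (Xs i).1 ≤
              ε + 2 * h * Real.sqrt (2 * (configEnergy Xs + 2⁻¹ * ∑ k, ‖V k‖ ^ 2))}.indicator 1 (P j) ≤
        ENNReal.ofReal ((s * m) * (K * (2 * h * Real.sqrt (2 * (configEnergy Xs + 2⁻¹ * ∑ k, ‖V k‖ ^ 2))))) := by
      calc _ ≤ ∑ _i : Fin s, ∑ _j : Fin m,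
            ENNReal.ofReal (K * (2 * h * Real.sqrt (2 * (configEnergy Xs + 2⁻¹ * ∑ k, ‖V k‖ ^ 2)))) :=
            Finset.sum_le_sum fun i _ => Finset.sum_le_sum fun j _ => by
              rw [hK]
              exact lintegral_shell_indicator_eval_le hε hε2 (Xs i).1 hw0 j
        _ = _ := by
            simp only [Finset.sum_const, Finset.card_univ, Fintype.card_fin, nsmul_eq_mul]
            rw [ENNReal.ofReal_mul (p := (s : ℝ) * m) (by positivity),
              ENNReal.ofReal_mul (p := (s : ℝ)) (Nat.cast_nonneg _),
              ENNReal.ofReal_natCast, ENNReal.ofReal_natCast]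
            rw [ENNReal.ofReal_mul (p := K) hK0]
            ring
    have key := sqrt_two_mul_mul_exp_neg_le hβ (add_nonneg hEX0 hEV0)
    have hgVe : Real.exp (-(β / 2) * (configEnergy Xs + 2⁻¹ * ∑ k, ‖V k‖ ^ 2)) =
        Real.exp (-(β / 2) * configEnergy Xs) * gV V := by
      rw [hgV, ← Real.exp_add]
      congr 1
      ring
    have hreal : Real.exp (-β * (configEnergy Xs + 2⁻¹ * ∑ k, ‖V k‖ ^ 2)) *
        ((s * m) * (K * (2 * h * Real.sqrt (2 * (configEnergy Xs + 2⁻¹ * ∑ k, ‖V k‖ ^ 2))))) ≤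
        h * C * Real.exp (-(β / 2) * configEnergy Xs) * gV V := by
      calc Real.exp (-β * (configEnergy Xs + 2⁻¹ * ∑ k, ‖V k‖ ^ 2)) *
            ((s * m) * (K * (2 * h * Real.sqrt (2 * (configEnergy Xs + 2⁻¹ * ∑ k, ‖V k‖ ^ 2)))))
          = (2 * h * (s * m) * K) * (Real.sqrt (2 * (configEnergy Xs + 2⁻¹ * ∑ k, ‖V k‖ ^ 2)) *
              Real.exp (-β * (configEnergy Xs + 2⁻¹ * ∑ k, ‖V k‖ ^ 2))) := by ring
        _ ≤ (2 * h * (s * m) * K) * ((1 + 4 / β) *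
              Real.exp (-(β / 2) * (configEnergy Xs + 2⁻¹ * ∑ k, ‖V k‖ ^ 2))) := by
            gcongr
        _ = h * C * Real.exp (-(β / 2) * configEnergy Xs) * gV V := by
            rw [hgVe, hC]; ring
    calc _ ≤ ENNReal.ofReal (Real.exp (-β * (configEnergy Xs + 2⁻¹ * ∑ k, ‖V k‖ ^ 2))) *
          ENNReal.ofReal ((s * m) * (K * (2 * h * Real.sqrt (2 * (configEnergy Xs + 2⁻¹ * ∑ k, ‖V k‖ ^ 2))))) :=
          mul_le_mul_right hsum _
      _ = ENNReal.ofReal (Real.exp (-β * (configEnergy Xs + 2⁻¹ * ∑ k, ‖V k‖ ^ 2)) *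
          ((s * m) * (K * (2 * h * Real.sqrt (2 * (configEnergy Xs + 2⁻¹ * ∑ k, ‖V k‖ ^ 2)))))) := by
          rw [← ENNReal.ofReal_mul (Real.exp_pos _).le]
      _ ≤ ENNReal.ofReal (h * C * Real.exp (-(β / 2) * configEnergy Xs) * gV V) :=
          ENNReal.ofReal_le_ofReal hreal
      _ = _ := by rw [← ENNReal.ofReal_mul (by positivity)]
  -- Step 4: the velocity integral
  have hstep4 : ∫⁻ V : Fin m → EuclideanSpace ℝ d, ENNReal.ofReal (gV V) = ENNReal.ofReal IV := by
    rw [hIV, ← ofReal_integral_eq_lintegral_ofReal hgi (Eventually.of_forall hgV0)]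
  calc _ = _ := hstep1
    _ ≤ ∫⁻ p, G p := lintegral_mono hle
    _ = _ := hT
    _ = ∫⁻ V : Fin m → EuclideanSpace ℝ d, R V := lintegral_congr hinner
    _ ≤ ∫⁻ V : Fin m → EuclideanSpace ℝ d,
          ENNReal.ofReal (h * C * Real.exp (-(β / 2) * configEnergy Xs)) * ENNReal.ofReal (gV V) :=
        lintegral_mono fun V => hstep3 V
    _ = ENNReal.ofReal (h * C * Real.exp (-(β / 2) * configEnergy Xs)) * ENNReal.ofReal IV := by
        rw [lintegral_const_mul _ (by exact ENNReal.measurable_ofReal.comp hgVm), hstep4]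
    _ = ENNReal.ofReal (h * (C * IV) * Real.exp (-(β / 2) * configEnergy Xs)) := by
        rw [← ENNReal.ofReal_mul (by positivity)]
        ring_nf

end Window

end

end Literature.MathematicalPhysics.KineticTheory
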